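import Summits.MatrixMultiplication.MatrixMultiplication.Theorems.SoloInformedValFourSet

/-!
# The rounding lemma for the packing–deficit inequality

Solo-informed MatrixMultiplication, gen 86 (CLAIMS c648; `work/g86/m7/M7.md` (I2)).

If the class `Y_a` is a translate `y₀ + B` of a finite additively closed set `B ∋ 0` (a finite subgroup given as a
finset), then the packing set `V_a = Y_a + ⋃_{c ≠ a} (X_c − Z_c)` (`crossV`) is invariant under translation by `B`,
hence a disjoint union of translates of `B`, so `|B|` divides `|V_a|` (`card_crossV_dvd`); likewise `|C|` divides
`|Ṽ_a|` when `Z_a = z₀ + C`.  Consequently the lower bounds `Σ_{c ≠ a} |X_c||Z_c| ≤ |V_a|` and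
`Σ_{c ≠ a} |X_c||Y_c| ≤ |Ṽ_a|` of `SoloInformedValFamilyBudget` / `SoloInformedValFourSet` may be ROUNDED UP to
multiples of `|B|`, `|C|` inside the packing–deficit inequality: `NoAccidental.packing_deficit_rounded`.  For pure
`𝔽₂` designs this is the inequality `(PD^round)` that settles the uniform volume bound at `m = 7`.

The divisibility statement `card_dvd_of_translate_invariant` is proved by strong induction on the invariant set
(remove one translate of `B` at a time).  Elementary; no `sorry`.
-/

namespace Summit.MatrixMultiplication.MatrixMultiplication.Theorems.SoloVal

open Finset

section Rounding

variable {G : Type*} [AddCommGroup G] [DecidableEq G]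

/-- A finset invariant under translation by every element of a finite set `B` which contains `0` and is closed under
addition and negation has cardinality divisible by `B.card`. -/
theorem card_dvd_of_translate_invariant (B : Finset G) (h0 : (0 : G) ∈ B)
    (hadd : ∀ b₁ ∈ B, ∀ b₂ ∈ B, b₁ + b₂ ∈ B) (hneg : ∀ b ∈ B, -b ∈ B) :
    ∀ S : Finset G, (∀ b ∈ B, ∀ s ∈ S, b + s ∈ S) → B.card ∣ S.card := by
  intro S
  induction S using Finset.strongInduction with
  | H S ih =>
    intro hS
    rcases S.eq_empty_or_nonempty with hSe | ⟨s, hs⟩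
    · simp [hSe]
    · have hBsS : B.image (fun b => b + s) ⊆ S := by
        intro g hg
        obtain ⟨b, hb, rfl⟩ := Finset.mem_image.mp hg
        exact hS b hb s hs
      have hBscard : (B.image (fun b => b + s)).card = B.card :=
        Finset.card_image_of_injective _ (fun b₁ b₂ h => add_right_cancel h)
      have hsBs : s ∈ B.image (fun b => b + s) := Finset.mem_image.mpr ⟨0, h0, zero_add s⟩
      have hsub : S \ B.image (fun b => b + s) ⊂ S := Finset.sdiff_ssubset hBsS ⟨s, hsBs⟩
      have hinv : ∀ b ∈ B, ∀ t ∈ S \ B.image (fun b => b + s), b + t ∈ S \ B.image (fun b => b + s) := by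
        intro b hb t ht
        rw [Finset.mem_sdiff] at ht ⊢
        refine ⟨hS b hb t ht.1, fun hmem => ht.2 ?_⟩
        obtain ⟨b', hb', hb't⟩ := Finset.mem_image.mp hmem
        refine Finset.mem_image.mpr ⟨b' + -b, hadd b' hb' (-b) (hneg b hb), ?_⟩
        calc b' + -b + s = (b' + s) - b := by abel
          _ = (b + t) - b := by rw [hb't]
          _ = t := by abel
      have hdv := ih _ hsub hinv
      have hcard := Finset.card_sdiff_add_card_eq_card hBsS
      have hS' : S.card = B.card + (S \ B.image (fun b => b + s)).card := by omega
      rw [hS']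
      exact dvd_add (dvd_refl _) hdv

variable {ι : Type*} [DecidableEq ι]
variable {T : Finset ι} {X Y Z : ι → Finset G} {a : ι}

/-- If the class `Y_a` is a translate `y₀ + B` of a finite additively closed, negation-closed set `B ∋ 0`, then
`|B|` divides `|V_a|` (`V_a = crossV T X Y Z a` is `B`-invariant). -/
theorem card_crossV_dvd (B : Finset G) (y₀ : G) (h0 : (0 : G) ∈ B)
    (hadd : ∀ b₁ ∈ B, ∀ b₂ ∈ B, b₁ + b₂ ∈ B) (hneg : ∀ b ∈ B, -b ∈ B)
    (hYa : Y a = B.image (fun b => y₀ + b)) :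
    B.card ∣ (crossV T X Y Z a).card := by
  apply card_dvd_of_translate_invariant B h0 hadd hneg
  intro b hb g hg
  rw [mem_crossV] at hg ⊢
  obtain ⟨y, hy, c, hc, x, hx, z, hz, rfl⟩ := hg
  rw [hYa, Finset.mem_image] at hy
  obtain ⟨b', hb', rfl⟩ := hy
  refine ⟨y₀ + (b + b'), ?_, c, hc, x, hx, z, hz, by abel⟩
  rw [hYa]
  exact Finset.mem_image.mpr ⟨b + b', hadd b hb b' hb', rfl⟩

/-- THE ROUNDED PACKING–DEFICIT INEQUALITY: in exponent two, if `Y_a = y₀ + B` and `Z_a = z₀ + C` are translates of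
finite additively closed sets containing `0`, then there are natural numbers `p, q` with
`Σ_{c ≠ a} |X_c||Z_c| ≤ |B|·p`, `Σ_{c ≠ a} |X_c||Y_c| ≤ |C|·q` and
`|X_a||Y_a||Z_a| + Σ_{b ≠ a} |Y_b||Z_b| + |B|·p + |C|·q ≤ |G|`
(namely `|B| p = |V_a|`, `|C| q = |Ṽ_a|`): the two difference-set budgets may be rounded up to multiples of `|B|` and
`|C|` in `NoAccidental.packing_deficit`. -/
theorem NoAccidental.packing_deficit_rounded [Fintype G] (h2 : ∀ g : G, g + g = 0)
    (hY : ∀ a ∈ T, ∀ b ∈ T, a ≠ b → Disjoint (Y a) (Y b))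
    (hZ : ∀ a ∈ T, ∀ b ∈ T, a ≠ b → Disjoint (Z a) (Z b))
    (hXne : ∀ c ∈ T, (X c).Nonempty) (hYne : ∀ c ∈ T, (Y c).Nonempty)
    (hZne : ∀ c ∈ T, (Z c).Nonempty)
    (hN : NoAccidental (id : G → G) id id (famPairs T X Y) (famPairs T Y Z) (famPairs T Z X))
    (ha : a ∈ T) {B C : Finset G} {y₀ z₀ : G} (hB0 : (0 : G) ∈ B)
    (hBadd : ∀ b₁ ∈ B, ∀ b₂ ∈ B, b₁ + b₂ ∈ B) (hC0 : (0 : G) ∈ C)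
    (hCadd : ∀ c₁ ∈ C, ∀ c₂ ∈ C, c₁ + c₂ ∈ C)
    (hYa : Y a = B.image (fun b => y₀ + b)) (hZa : Z a = C.image (fun c => z₀ + c)) :
    ∃ p q : ℕ, ∑ c ∈ T.erase a, (X c).card * (Z c).card ≤ B.card * p ∧
      ∑ c ∈ T.erase a, (X c).card * (Y c).card ≤ C.card * q ∧
      (X a).card * (Y a).card * (Z a).card + ∑ b ∈ T.erase a, (Y b).card * (Z b).card +
        B.card * p + C.card * q ≤ Fintype.card G := by
  have hneg : ∀ S : Finset G, ∀ b ∈ S, -b ∈ S := fun S b hb => by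
    rwa [neg_eq_of_add_eq_zero_left (h2 b)]
  have hcrit : ∀ c ∈ T, FamilyCriterionAt T X Y Z c :=
    fun c hc => familyCriterion_of_noAccidental hY hZ hN hc
  obtain ⟨p, hp⟩ := card_crossV_dvd (T := T) (X := X) (Z := Z) B y₀ hB0 hBadd (hneg B) hYa
  obtain ⟨q, hq⟩ := card_crossV_dvd (T := T) (X := X) (Y := Z) (Z := Y) C z₀ hC0 hCadd (hneg C) hZa
  refine ⟨p, q, ?_, ?_, ?_⟩
  · have h := card_crossV_ge hcrit hYne ha
    rwa [hp] at h
  · have h := NoAccidental.sum_card_mul_card_le_card_crossVt hY hZ hZne hN ha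
    rwa [hq] at h
  · have h₁ := card_crossU_ge hcrit hXne ha
    have h₄ := NoAccidental.fourSet_card_le h2 hY hZ hN ha
    rw [hp, hq] at h₄
    omega

end Rounding

end Summit.MatrixMultiplication.MatrixMultiplication.Theorems.SoloVal
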